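import Mathlib

/-!
# The mixed frame of a tuple — crux stmt-Schanuel-0969 `RigidCore.MinimalCounterexampleInAcl`

Line `kernel-arithmetic-selection` (lead prover-line-stmt-Schanuel-0969-c5-0): this file proves the registered stub
`stub_mixedFrame`, the normal form of the MIXED LATTICE of an ARBITRARY tuple `x : Fin n → ℂ` (no hypothesis on `x`),
`Λ(x) = {M ∈ ℤⁿ | e^{Σ Mᵢxᵢ} ∈ ℚ̄}` — the datum by which the sector decomposition of (S*) is organised.

* the mixed lattice is a `ℤ`-submodule of `ℤⁿ` (`exists_mixedLattice`; `e⁰ = 1`, `e^{a+b} = e^a e^b`, `e^{ka} = (e^a)^k`,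
  and `ℚ̄ ⊆ ℂ` is a field) — stated as an existence so that this `--supports` file introduces no definition;
* it is SATURATED (`mixedLattice_saturated`): `k ≠ 0`, `kM ∈ Λ ⇒ M ∈ Λ`, because `z ^ k ∈ ℚ̄ ⇒ z ∈ ℚ̄` for `k ≠ 0`
  (`mixedFrame_isAlgebraic_of_zpow`);
* a saturated submodule `N ⊆ ℤⁿ` has an ADAPTED ORDERED BASIS (`exists_adaptedBasis_of_saturated`): by Smith normal form
  (`Submodule.smithNormalForm` on `Pi.basisFun`) there are a basis `bM` of `ℤⁿ`, an embedding `f : Fin k ↪ Fin n` and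
  `aᵢ ≠ 0` with `N ⊆ ⊕_{range f} ℤ·bM` and `aᵢ • bM (f i) ∈ N`; saturation upgrades this to `bM (f i) ∈ N`, and a permutation
  of `Fin n` extending `Fin.castLE i ↦ f i` (`Equiv.Perm.exists_extending_pair`) re-indexes `bM` so that `range f` becomes
  the initial segment `{i < k}`;
* `stub_mixedFrame`: the rows of that basis form `A ∈ GLₙ(ℤ)` (its inverse `B` lists the coordinates of the standard basis),
  the first `r = k` new coordinates `x'ᵢ = Σⱼ Aᵢⱼ xⱼ` have algebraic exponentials, and every integer combination of the new
  coordinates that involves a row `≥ r` has a transcendental exponential (its `bM`-coordinate vector is `M`, non-zero beyond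
  the initial segment, so it is not in `Λ(x)`).

Edge cases are uniform: `n = 0` (all vacuous), `Λ = ℤⁿ` (`r = n`), `Λ = 0` (`r = 0`).  Mathlib only.
-/

noncomputable section

set_option linter.dupNamespace false

open Complex Set Module

namespace Summit.Schanuel.Schanuel.Cruxes.MinimalCounterexampleInAcl.KernelArithmeticSelection

variable {n : ℕ}

/-! ## Algebraic numbers with an algebraic power -/

/-- A complex number with an algebraic `c`-th power, `c ≠ 0` an integer, is algebraic. -/
theorem mixedFrame_isAlgebraic_of_zpow {z : ℂ} {c : ℤ} (hc : c ≠ 0) (hz : IsAlgebraic ℚ (z ^ c)) :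
    IsAlgebraic ℚ z := by
  cases c with
  | ofNat m =>
    rw [Int.ofNat_eq_natCast, zpow_natCast] at hz
    rw [Int.ofNat_eq_natCast, Int.natCast_ne_zero] at hc
    exact hz.of_pow (Nat.pos_of_ne_zero hc)
  | negSucc m =>
    rw [zpow_negSucc, IsAlgebraic.inv_iff] at hz
    exact hz.of_pow m.succ_pos

/-! ## The mixed lattice -/

/-- The MIXED LATTICE of a tuple `x : Fin n → ℂ` — the integer vectors `M` with `e^{Σ Mᵢ xᵢ}` algebraic over `ℚ` — is a
`ℤ`-submodule of `ℤⁿ` (closed under `0`, `+` and integer multiples because `e⁰ = 1`, `e^{a+b} = e^a e^b`,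
`e^{ka} = (e^a)^k` and the algebraic numbers form a subfield `algebraicClosure ℚ ℂ` of `ℂ`).  Stated as the existence of a submodule with this
carrier, so that the file introduces no definition. -/
theorem exists_mixedLattice (x : Fin n → ℂ) :
    ∃ N : Submodule ℤ (Fin n → ℤ), ∀ M : Fin n → ℤ, M ∈ N ↔ IsAlgebraic ℚ (cexp (∑ i, (M i : ℂ) * x i)) :=
  ⟨{ carrier := {M | IsAlgebraic ℚ (cexp (∑ i, (M i : ℂ) * x i))}
     add_mem' := fun {M N} hM hN => by
       simp only [Set.mem_setOf_eq, Pi.add_apply, Int.cast_add, add_mul, Finset.sum_add_distrib,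
         Complex.exp_add] at hM hN ⊢
       exact hM.mul hN
     zero_mem' := by simpa using isAlgebraic_one
     smul_mem' := fun c M hM => by
       simp only [Set.mem_setOf_eq, Pi.smul_apply, smul_eq_mul, Int.cast_mul, mul_assoc,
         ← Finset.mul_sum, Complex.exp_int_mul] at hM ⊢
       exact mem_algebraicClosure_iff.1 (zpow_mem (mem_algebraicClosure_iff.2 hM) c) }, fun _ => Iff.rfl⟩

/-- The mixed lattice is SATURATED: `k ≠ 0` and `k • M ∈ Λ(x)` imply `M ∈ Λ(x)` (because `e^{Σ (kM)ᵢ xᵢ} = (e^{Σ Mᵢxᵢ})^k`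
and `mixedFrame_isAlgebraic_of_zpow`). -/
theorem mixedLattice_saturated (x : Fin n → ℂ) {N : Submodule ℤ (Fin n → ℤ)}
    (hN : ∀ M : Fin n → ℤ, M ∈ N ↔ IsAlgebraic ℚ (cexp (∑ i, (M i : ℂ) * x i)))
    (k : ℤ) (hk : k ≠ 0) (M : Fin n → ℤ) (hM : k • M ∈ N) : M ∈ N := by
  rw [hN] at hM ⊢
  simp only [Pi.smul_apply, smul_eq_mul, Int.cast_mul, mul_assoc, ← Finset.mul_sum,
    Complex.exp_int_mul] at hM
  exact mixedFrame_isAlgebraic_of_zpow hk hM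

/-! ## Saturated sublattices of `ℤⁿ` have adapted ordered bases -/

/-- A SATURATED submodule `N ⊆ ℤⁿ` has an ADAPTED ORDERED BASIS: a basis `b` of `ℤⁿ` indexed by `Fin n` and `r ≤ n` such
that `b i ∈ N` for `i < r` while every element of `N` has vanishing `b`-coordinates at the indices `≥ r` (so
`N = ⊕_{i<r} ℤ·bᵢ`).  Smith normal form, then a permutation of the index set putting `range f` first. -/
theorem exists_adaptedBasis_of_saturated (N : Submodule ℤ (Fin n → ℤ))
    (hsat : ∀ k : ℤ, k ≠ 0 → ∀ v : Fin n → ℤ, k • v ∈ N → v ∈ N) :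
    ∃ (b : Basis (Fin n) ℤ (Fin n → ℤ)) (r : ℕ), r ≤ n ∧ (∀ i : Fin n, (i : ℕ) < r → b i ∈ N) ∧
      ∀ v ∈ N, ∀ i : Fin n, r ≤ (i : ℕ) → b.repr v i = 0 := by
  obtain ⟨k, snf⟩ := Submodule.smithNormalForm (Pi.basisFun ℤ (Fin n)) N
  have hkn : k ≤ n := by simpa using Fintype.card_le_of_embedding snf.f
  obtain ⟨σ, hσ⟩ := Equiv.Perm.exists_extending_pair (Fin.castLE hkn) snf.f
    (Fin.castLE_injective hkn) snf.f.injective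
  refine ⟨snf.bM.reindex σ.symm, k, hkn, fun i hi => ?_, fun v hv i hi => ?_⟩
  · have hfi : σ i = snf.f ⟨i, hi⟩ := by rw [← hσ]; rfl
    rw [Basis.reindex_apply, Equiv.symm_symm, hfi]
    have ha : snf.a ⟨i, hi⟩ ≠ 0 := by
      intro h0
      have h := snf.snf ⟨i, hi⟩
      rw [h0, zero_smul, Submodule.coe_eq_zero] at h
      exact snf.bN.ne_zero _ h
    refine hsat _ ha _ ?_
    rw [← snf.snf]
    exact (snf.bN ⟨i, hi⟩).2
  · rw [Basis.repr_reindex_apply, Equiv.symm_symm]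
    refine snf.repr_eq_zero_of_notMem_range ⟨v, hv⟩ ?_
    rintro ⟨j, hj⟩
    have hji : Fin.castLE hkn j = i := σ.injective (by rw [hσ, hj])
    have : (i : ℕ) = j := by rw [← hji]; rfl
    omega

/-! ## The mixed frame -/

/-- **Mixed frame (curried form).**  For every tuple `x : Fin n → ℂ` there are `A ∈ GLₙ(ℤ)` (with two-sided inverse `B`,
stated as `A * B = 1`) and `r ≤ n` such that the new coordinates `x'ᵢ = Σⱼ Aᵢⱼ xⱼ` satisfy: `e^{x'ᵢ}` is algebraic for
`i < r`, and `e^{Σᵢ Mᵢ x'ᵢ}` is transcendental for every integer vector `M` with a non-zero entry at some row `i ≥ r`.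
(The rows of `A` are an adapted ordered basis of `ℤⁿ` for the saturated mixed lattice of `x`.) -/
theorem exists_mixedFrame (n : ℕ) (x : Fin n → ℂ) :
    ∃ (A B : Matrix (Fin n) (Fin n) ℤ) (r : ℕ), A * B = 1 ∧ r ≤ n ∧
      (∀ i : Fin n, (i : ℕ) < r → IsAlgebraic ℚ (Complex.exp (∑ j, (A i j : ℂ) * x j))) ∧
      (∀ M : Fin n → ℤ, (∃ i : Fin n, r ≤ (i : ℕ) ∧ M i ≠ 0) →
        Transcendental ℚ (Complex.exp (∑ i, (M i : ℂ) * ∑ j, (A i j : ℂ) * x j))) := by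
  obtain ⟨N, hN⟩ := exists_mixedLattice x
  obtain ⟨b, r, hrn, hmem, hrepr⟩ := exists_adaptedBasis_of_saturated N (mixedLattice_saturated x hN)
  refine ⟨Matrix.of fun i j => b i j, Matrix.of fun i j => b.repr (Pi.single i 1) j, r, ?_, hrn,
    fun i hi => ?_, fun M hM => ?_⟩
  · -- `A * B = 1`, proved as `B * A = 1`: the standard basis expanded in `b`
    rw [mul_eq_one_comm]
    ext i l
    have h := congrFun (b.sum_repr (Pi.single i 1)) l
    simp only [Finset.sum_apply, Pi.smul_apply, smul_eq_mul] at h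
    rw [Matrix.mul_apply]
    simp only [Matrix.of_apply]
    rw [h, Matrix.one_eq_pi_single]
  · simpa using (hN _).1 (hmem i hi)
  · obtain ⟨i₀, hi₀, hMi₀⟩ := hM
    have hv : (∑ i, M i • b i) ∉ N := by
      intro hv
      have h := hrepr _ hv i₀ hi₀
      rw [b.repr_sum_self] at h
      exact hMi₀ h
    intro halg
    apply hv
    rw [hN]
    convert halg using 2
    simp only [Matrix.of_apply, Finset.sum_apply, Pi.smul_apply, smul_eq_mul, Int.cast_sum, Int.cast_mul,
      Finset.sum_mul, Finset.mul_sum]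
    rw [Finset.sum_comm]
    simp only [mul_assoc]

/-- **Registered stub `stub_mixedFrame`** (line `kernel-arithmetic-selection`, crux stmt-Schanuel-0969): the mixed-lattice
normal form of an arbitrary tuple, uncurried registered form of `exists_mixedFrame`. -/
theorem stub_mixedFrame : ∀ (n : ℕ) (x : Fin n → ℂ), ∃ (A B : Matrix (Fin n) (Fin n) ℤ) (r : ℕ), A * B = 1 ∧ r ≤ n ∧ (∀ i : Fin n, (i : ℕ) < r → IsAlgebraic ℚ (Complex.exp (∑ j, (A i j : ℂ) * x j))) ∧ (∀ M : Fin n → ℤ, (∃ i : Fin n, r ≤ (i : ℕ) ∧ M i ≠ 0) → Transcendental ℚ (Complex.exp (∑ i, (M i : ℂ) * ∑ j, (A i j : ℂ) * x j))) :=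
  exists_mixedFrame

end Summit.Schanuel.Schanuel.Cruxes.MinimalCounterexampleInAcl.KernelArithmeticSelection
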